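import Summits.Ventures.GridStability.Bench.CHIANG3Deg4ARecertDDeg4A8eqbLowhRoaBallModel
import Summits.Ventures.GridStability.Bench.CHIANG3Deg4ARecertDDeg4A8eqbLowhBallS8
import HarnessLib

/-!
# G1.a′+ «CHIANG3 deg-4» — rider «CHIANG3-DEG4 BALL+» (sub-box cover K = 8, supersession `_S8`) (model half): a Euclidean ball of MACHINE STATES of the 3-machine Chiang
# cycle (machine 3 = infinite bus) around the stable equilibrium point inside the degree-4 certified region, with the ROA sentence

Venture GRIDFUSION, cell `gridfusion`; seat gridfusion-lyap-2 (generator g4; filed by g5 as the SUPERSESSION «BALL+» of `Bench/CHIANG3Deg4ARecertDDeg4A8eqbLowhRoaBallModel.lean` p552412 under NEW names: `Bench/CHIANG3Deg4ARecertDDeg4A8eqbLowhRoaBallS8Model.lean`, declarations suffixed `_S8`; files of record untouched); LOW rider (pattern of «#50′ BALL» p542326 / «#62′» p544490).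
Sibling of `CHIANG3Deg4ARecertDDeg4A8eqbLowhBallS8.lean` (recast half: gauge ball `Σ(σ_k² + κ_k²) + Σω_k² ≤ (441/500)²` ∩ {h = 0} ⊆
{V₄ ≤ 49199/50000}, sub-box cover, one `decide` per box on `Lyapunov/PolyRecastBox`) and of the deg-4 model half
`CHIANG3Deg4ARecertDDeg4A8eqbLowhRoaModel.lean` (`…_model_roa`, lyap-2 g4), imported through the model half of record; embedding vocabulary = lyap-1's
`deg2_A_recertD_A8eqb_Z δs x = (sin u₁, 1 − cos u₁, sin u₂, 1 − cos u₂, ω₁ − ω₀, ω₂ − ω₀)` and `…_Z_mem_M`. Reused fact: `sin²u + (1 −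
cos u)² ≤ u²` per machine angle (`…_ballsum_Z_le`, CITED BY NAME from the model half of record
`CHIANG3Deg4ARecertDDeg4A8eqbLowhRoaBallModel.lean` p552412, which this file imports); new here is only the packaging; the window hypothesis `|u_i(0)| < π` of `…_model_roa` is
discharged by the ball (`u_i² ≤ s² ≤ 2 < π²`).

STATEMENT (`deg4_A_recertD_deg4_A8eqb_lowh_model_roa_ball_S8`): for equilibrium angles `δs` with `Chiang3.data.EqData δs`, any bus
angle `δ₀` and every infinite-bus solution `c` of `Chiang3.data` on `[0, ∞)` (`Chiang3.data.IsInfBusSolutionOn δ₀ c (Ici 0)`: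
machines 1, 2 follow the classical swing field, bus angle frozen, bus speed deviation `0`) whose INITIAL MACHINE STATE satisfies
`u₁(0)² + u₂(0)² + ω₁(0)² + ω₂(0)² ≤ (441/500)²` (`u_k` = rotor-angle deviation of machine `k` from the equilibrium, `ω_k` = its
speed deviation; renderings of `s = 441/500`, VALIDATED column only: ONE angle displaced by ≤ 0.882 rad = 50.5°, or both by ≤ 35.7°,
or one speed deviation ≤ 0.882): `V₄ ≤ 49199/50000` along the recast state for all `t ≥ 0`, no angle deviation ever reaches `±π` (no
pole slip), every `u_k(t) → 0` and every `ω_k(t) → 0`.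

THREE COLUMNS. CERTIFIED (kernel): the inclusion of the ball in the certified piece (recast half) + this packaging. MODELLED: as the
parent row G1.a′ deg-4 (M′ = Chiang–Chu–Cauley 3-machine test system as typed by model-1 (`Models/Chiang3.lean`: machine 3 =
reference / infinite bus, network-reduced classical model with LOSSLESS couplings — transfer conductances `G = 0`, susceptances `B =
(1, 1/2, 1/2)`, unit voltages — damping `D = (2/5, 1/2)`, dimensionless `M = 1`; the word «lossy» in the Bench certificate file's
header is a template slip, the typed data decide `G = 0`), instance CHIANG3 eq=b at the exact SEP; MODEL-VALIDITY per model-2's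
CHIANG3 row; speeds in the model's dimensionless units). VALIDATED: only the renderings of `s` (sos-3's comparison with the printed
ROA figures of Chiang 2011 is the parent row's VALIDATED column). No sentence here says a machine or a grid is stable; the ball is a
set of initial states OF THE MODEL M′ inside a CERTIFICATE's sublevel piece (a crude coefficient-majorant inner description of it),
carried to the equilibrium of M′ without pole slip — never «the ROA of the system».
-/

namespace Summit.Ventures.GridStability.Bench.CHIANG3

open Set Filter Metric Topology Real
open Summit.Ventures.GridStability.Lyapunov Summit.Ventures.GridStability.Models
open Literature.Computation.Certificates Literature.Computation.Certificates.SOS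

noncomputable section

/-- **The machine-coordinate ball lies in the certified piece**: `u₁² + u₂² + (ω₁ − ω₀)² + (ω₂ − ω₀)² ≤ (441/500)²` ⇒
`V₄(Z x) ≤ 49199/50000`. [folklore] -/
theorem deg4_A_recertD_deg4_A8eqb_lowh_Vz_le_level_of_machine_ball_S8 (δs : Fin 3 → ℝ) (x : ClassicalSwing.State 3)
    (hball : RecastData.u δs x 1 ^ 2 + RecastData.u δs x 2 ^ 2 + (x.2 1 - x.2 0) ^ 2 + (x.2 2 - x.2 0) ^ 2 ≤ (441 / 500 : ℝ) ^ 2) :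
    deg4_A_recertD_deg4_A8eqb_lowh_Vz (deg2_A_recertD_A8eqb_Z δs x) ≤ deg4_A_recertD_deg4_A8eqb_lowh_level := by
  have hM := deg4_A_recertD_deg4_A8eqb_lowh_Z_mem_M δs x
  have hZ := deg4_A_recertD_deg4_A8eqb_lowh_ballsum_Z_le δs x
  show deg4_A_recertD_deg4_A8eqb_lowh_V (deg2_A_recertD_A8eqb_Z δs x 0) (deg2_A_recertD_A8eqb_Z δs x 1) (deg2_A_recertD_A8eqb_Z δs x 2) (deg2_A_recertD_A8eqb_Z δs x 3) (deg2_A_recertD_A8eqb_Z δs x 4) (deg2_A_recertD_A8eqb_Z δs x 5) ≤ 49199 / 50000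
  exact deg4_A_recertD_deg4_A8eqb_lowh_V_le_level_of_ball_S8 _ _ _ _ _ _ hM.1 hM.2 (by linarith)

/-- **«CHIANG3-DEG4 BALL» — the ROA sentence from a Euclidean ball of machine states (3-machine Chiang cycle, machine 3 = infinite
bus, deg-4 certificate).** For `δs` with `Chiang3.data.EqData δs`, any `δ₀`, and every infinite-bus solution `c` on `[0, ∞)` with
`u₁(0)² + u₂(0)² + ω₁(0)² + ω₂(0)² ≤ (441/500)²`: `V₄(Z(c t)) ≤ 49199/50000` for all `t ≥ 0`, no pole slip, `u_k(t) → 0`, `ω_k(t) → 0`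
(`k = 1, 2`). MODELLED/CERTIFIED columns as in the module docstring. [folklore] -/
theorem deg4_A_recertD_deg4_A8eqb_lowh_model_roa_ball_S8 {δs : Fin 3 → ℝ} (hEq : Chiang3.data.EqData δs) {δ₀ : ℝ}
    {c : ℝ → ClassicalSwing.State 3} (hc : Chiang3.data.IsInfBusSolutionOn δ₀ c (Ici 0))
    (hball : RecastData.u δs (c 0) 1 ^ 2 + RecastData.u δs (c 0) 2 ^ 2 + (c 0).2 1 ^ 2 + (c 0).2 2 ^ 2 ≤ (441 / 500 : ℝ) ^ 2) :
    (∀ t, 0 ≤ t → deg4_A_recertD_deg4_A8eqb_lowh_Vz (deg2_A_recertD_A8eqb_Z δs (c t)) ≤ deg4_A_recertD_deg4_A8eqb_lowh_level) ∧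
    (∀ i : Fin 2, ∀ t, 0 ≤ t → |RecastData.u δs (c t) i.succ| < π) ∧
    (∀ i : Fin 2, Tendsto (fun t ↦ RecastData.u δs (c t) i.succ) atTop (𝓝 0)) ∧
    (∀ i : Fin 2, Tendsto (fun t ↦ (c t).2 i.succ) atTop (𝓝 0)) := by
  have hω0 : (c 0).2 0 = 0 := (hc 0 (le_refl (0 : ℝ))).2.1
  have hball' : RecastData.u δs (c 0) 1 ^ 2 + RecastData.u δs (c 0) 2 ^ 2 + ((c 0).2 1 - (c 0).2 0) ^ 2 +
      ((c 0).2 2 - (c 0).2 0) ^ 2 ≤ (441 / 500 : ℝ) ^ 2 := by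
    simpa [hω0] using hball
  have hV := deg4_A_recertD_deg4_A8eqb_lowh_Vz_le_level_of_machine_ball_S8 δs (c 0) hball'
  have hsq : 0 ≤ (c 0).2 1 ^ 2 + (c 0).2 2 ^ 2 := by positivity
  have hwin : ∀ i : Fin 2, |RecastData.u δs (c 0) i.succ| < π := by
    intro i
    have hsq1 : RecastData.u δs (c 0) i.succ ^ 2 ≤ (2 : ℝ) ^ 2 := by
      fin_cases i
      · show RecastData.u δs (c 0) 1 ^ 2 ≤ (2 : ℝ) ^ 2
        nlinarith [sq_nonneg (RecastData.u δs (c 0) 2), hsq]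
      · show RecastData.u δs (c 0) 2 ^ 2 ≤ (2 : ℝ) ^ 2
        nlinarith [sq_nonneg (RecastData.u δs (c 0) 1), hsq]
    have h1 := abs_le_of_sq_le_sq' hsq1 (by norm_num)
    exact abs_lt.2 ⟨by linarith [Real.pi_gt_three, h1.1], by linarith [Real.pi_gt_three, h1.2]⟩
  have hγ0 : (0 : ℝ) < deg4_A_recertD_deg4_A8eqb_lowh_level := by
    unfold deg4_A_recertD_deg4_A8eqb_lowh_level; norm_num
  exact deg4_A_recertD_deg4_A8eqb_lowh_model_roa hEq hγ0 le_rfl hc hV hwin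

end

end Summit.Ventures.GridStability.Bench.CHIANG3
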